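import Summits.Parity.GeneralizedHardyLittlewood.Theorems.CellParityLawSaving.Negative.CornerSqueeze
import HarnessLib

/-!
# Crux `CellParityLawSaving` (stmt-Parity-18104): the amplitude box `|θ_S| ≤ 2` is redundant up to `o(1)`

Negative-side support from the crux disprover (cdisprove seat, cycle 1), fourth file — a TIGHTNESS fact about the
conclusion block of `LeeYangFibres.CellParityLawSaving` (nothing is asserted about the crux; theorems only).

Walsh inversion on the `2^t` corner cells `j ∈ {1,2}^t` (`sum_walshForm_mul_chi`:
`Σ_j W_θ(j) χ_S(j) = 2^t θ_S`, `χ_S(j) = ∏_{i∈S} (−1)^{j_i+1}`, with `chi_mul_chi`, `abs_chi`, `sum_chi_pairs`) gives: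

* `abs_amplitude_le_one` — if the corner weights `W_θ(j)` are non-negative and `θ_∅ = 1` then `|θ_S| ≤ 1` for
  EVERY `S`;
* `abs_amplitude_le` — quantitatively, corner weights `≥ −κ` and `θ_∅ = 1` give `|θ_S| ≤ 1 + 2κ`.

Since the cells are counts, the law's conclusion forces `W_θ(j) ≥ −allowance/M_j` on every corner whose model
`M_j` is not tiny, so the planner's box `|θ_S| ≤ 2` carries slack `1 − o(1)`: a prover may DEFINE `θ` as the
normalised Walsh transform of the corner ratios `C_j/M_j` and gets the box for free.  This file does NOT refute
the crux. [folklore]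
-/

noncomputable section

namespace Summit.Parity.GeneralizedHardyLittlewood.Theorems.CellParityLawSaving.Negative

open scoped BigOperators Classical
open Finset
open Summit.Parity.GeneralizedHardyLittlewood.Cruxes.AbsoluteUpgrade.NlcCellsAbsoluteClip (walshForm)

/-- `χ_S(j)² = 1`, indeed `χ_S(j) ∈ {±1}`. [folklore] -/
theorem chi_mul_self {t : ℕ} (S : Finset (Fin t)) (j : Fin t → ℕ) : (∏ i ∈ S, (-1 : ℝ) ^ (j i + 1)) * (∏ i ∈ S, (-1 : ℝ) ^ (j i + 1)) = 1 := by
  rw [← Finset.prod_mul_distrib]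
  refine Finset.prod_eq_one fun i _ => ?_
  rw [← pow_add, ← two_mul, pow_mul]
  norm_num

/-- `|χ_S(j)| = 1`. [folklore] -/
theorem abs_chi {t : ℕ} (S : Finset (Fin t)) (j : Fin t → ℕ) : |(∏ i ∈ S, (-1 : ℝ) ^ (j i + 1))| = 1 := by
  have h := chi_mul_self S j
  have : |(∏ i ∈ S, (-1 : ℝ) ^ (j i + 1))| * |(∏ i ∈ S, (-1 : ℝ) ^ (j i + 1))| = 1 := by rw [← abs_mul, h, abs_one]
  nlinarith [abs_nonneg ((∏ i ∈ S, (-1 : ℝ) ^ (j i + 1)))]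

/-- Multiplicativity: `χ_T χ_S = χ_{T ∆ S}` on corners (signs square to one). [folklore] -/
theorem chi_mul_chi {t : ℕ} (T S : Finset (Fin t)) (j : Fin t → ℕ) :
    (∏ i ∈ T, (-1 : ℝ) ^ (j i + 1)) * (∏ i ∈ S, (-1 : ℝ) ^ (j i + 1)) = (∏ i ∈ symmDiff T S, (-1 : ℝ) ^ (j i + 1)) := by
  classical
  -- write both sides over `univ` with indicator exponents
  have key : ∀ R : Finset (Fin t), ∏ i ∈ R, (-1 : ℝ) ^ (j i + 1) =
      ∏ i : Fin t, (if i ∈ R then (-1 : ℝ) ^ (j i + 1) else 1) := by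
    intro R; rw [Finset.prod_ite_mem, Finset.univ_inter]
  rw [key T, key S, key (symmDiff T S), ← Finset.prod_mul_distrib]
  refine Finset.prod_congr rfl fun i _ => ?_
  have hsq : (-1 : ℝ) ^ (j i + 1) * (-1 : ℝ) ^ (j i + 1) = 1 := by
    rw [← pow_add, ← two_mul, pow_mul]; norm_num
  by_cases hT : i ∈ T <;> by_cases hS : i ∈ S <;>
    simp [hT, hS, Finset.mem_symmDiff, hsq]

/-- Orthogonality: `Σ_{j ∈ {1,2}^t} χ_R(j) = 2^t` if `R = ∅`, else `0`. [folklore] -/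
theorem sum_chi_pairs {t : ℕ} (R : Finset (Fin t)) :
    ∑ j ∈ Fintype.piFinset (fun _ : Fin t => ({1, 2} : Finset ℕ)), (∏ i ∈ R, (-1 : ℝ) ^ (j i + 1)) =
      if R = ∅ then (2 : ℝ) ^ t else 0 := by
  classical
  -- the one-amplitude Walsh sum with `θ = 𝟙_{R}`
  have h := sum_walshForm_pairs (t := t) (fun S => if S = R then (1 : ℝ) else 0)
  unfold walshForm at h
  simp only [ite_mul, one_mul, zero_mul, Finset.sum_ite_eq', Finset.mem_univ, if_true] at h
  rw [h]
  by_cases hR : R = ∅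
  · subst hR; simp
  · rw [if_neg hR, if_neg (Ne.symm hR), mul_zero]

/-- **Walsh inversion on the corners**: `Σ_j W_θ(j) χ_S(j) = 2^t θ_S`. [folklore] -/
theorem sum_walshForm_mul_chi {t : ℕ} (θ : Finset (Fin t) → ℝ) (S : Finset (Fin t)) :
    ∑ j ∈ Fintype.piFinset (fun _ : Fin t => ({1, 2} : Finset ℕ)), walshForm θ j * (∏ i ∈ S, (-1 : ℝ) ^ (j i + 1)) = 2 ^ t * θ S := by
  classical
  have hexp : ∀ j : Fin t → ℕ, walshForm θ j * (∏ i ∈ S, (-1 : ℝ) ^ (j i + 1)) = ∑ T : Finset (Fin t), θ T * (∏ i ∈ symmDiff T S, (-1 : ℝ) ^ (j i + 1)) := by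
    intro j
    unfold walshForm
    rw [Finset.sum_mul]
    refine Finset.sum_congr rfl fun T _ => ?_
    rw [mul_assoc, ← chi_mul_chi T S j]
  simp_rw [hexp]
  rw [Finset.sum_comm]
  simp_rw [← Finset.mul_sum, sum_chi_pairs]
  simp only [mul_ite, mul_zero]
  rw [Finset.sum_ite, Finset.sum_const_zero, add_zero]
  have hfilter : (Finset.univ.filter fun T : Finset (Fin t) => symmDiff T S = ∅) = {S} := by
    ext T
    simp only [Finset.mem_filter, Finset.mem_univ, true_and, Finset.mem_singleton]
    rw [← Finset.bot_eq_empty, symmDiff_eq_bot]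
  rw [hfilter, Finset.sum_singleton, mul_comm]

/-- **The amplitude box is redundant up to `o(1)`**: non-negative corner weights and `θ_∅ = 1` force `|θ_S| ≤ 1`
for EVERY `S` (so the crux's `|θ_S| ≤ 2` has slack `1`). [folklore] -/
theorem abs_amplitude_le_one {t : ℕ} {θ : Finset (Fin t) → ℝ} (hθ : θ ∅ = 1)
    (hpos : ∀ j ∈ Fintype.piFinset (fun _ : Fin t => ({1, 2} : Finset ℕ)), 0 ≤ walshForm θ j) (S : Finset (Fin t)) :
    |θ S| ≤ 1 := by
  have h2t : (0 : ℝ) < 2 ^ t := by positivity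
  have hinv := sum_walshForm_mul_chi θ S
  have hmean := sum_walshForm_pairs θ
  rw [hθ, mul_one] at hmean
  have hbound : |∑ j ∈ Fintype.piFinset (fun _ : Fin t => ({1, 2} : Finset ℕ)), walshForm θ j * (∏ i ∈ S, (-1 : ℝ) ^ (j i + 1))| ≤ 2 ^ t := by
    refine (Finset.abs_sum_le_sum_abs _ _).trans ?_
    rw [← hmean]
    refine Finset.sum_le_sum fun j hj => ?_
    rw [abs_mul, abs_chi, mul_one, abs_of_nonneg (hpos j hj)]
  rw [hinv, abs_mul, abs_of_pos h2t] at hbound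
  have : |θ S| ≤ 2 ^ t / 2 ^ t := by
    rw [le_div_iff₀ h2t]; linarith
  rwa [div_self h2t.ne'] at this

/-- Quantitative form used by provers: corner weights `≥ −κ` and `θ_∅ = 1` give `|θ_S| ≤ 1 + 2κ`·(well, `1 + κ`
per corner on average): `|θ_S| ≤ 1 + 2κ`. [folklore] -/
theorem abs_amplitude_le {t : ℕ} {θ : Finset (Fin t) → ℝ} (hθ : θ ∅ = 1) {κ : ℝ} (hκ : 0 ≤ κ)
    (hpos : ∀ j ∈ Fintype.piFinset (fun _ : Fin t => ({1, 2} : Finset ℕ)), -κ ≤ walshForm θ j) (S : Finset (Fin t)) :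
    |θ S| ≤ 1 + 2 * κ := by
  have h2t : (0 : ℝ) < 2 ^ t := by positivity
  have hinv := sum_walshForm_mul_chi θ S
  have hmean := sum_walshForm_pairs θ
  rw [hθ, mul_one] at hmean
  set J := Fintype.piFinset (fun _ : Fin t => ({1, 2} : Finset ℕ)) with hJ
  have hcard : (J.card : ℝ) = 2 ^ t := by
    rw [hJ, Fintype.card_piFinset]
    simp [Finset.card_pair (show (1 : ℕ) ≠ 2 by norm_num)]
  -- `|W| ≤ W + 2κ` when `W ≥ -κ`
  have hbound : |∑ j ∈ J, walshForm θ j * (∏ i ∈ S, (-1 : ℝ) ^ (j i + 1))| ≤ 2 ^ t + 2 * κ * 2 ^ t := by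
    refine (Finset.abs_sum_le_sum_abs _ _).trans ?_
    have hle : ∀ j ∈ J, |walshForm θ j * (∏ i ∈ S, (-1 : ℝ) ^ (j i + 1))| ≤ walshForm θ j + 2 * κ := by
      intro j hj
      rw [abs_mul, abs_chi, mul_one]
      have := hpos j hj
      rcases le_or_gt 0 (walshForm θ j) with h | h
      · rw [abs_of_nonneg h]; linarith
      · rw [abs_of_neg h]; linarith
    refine (Finset.sum_le_sum hle).trans ?_
    rw [Finset.sum_add_distrib, hmean, Finset.sum_const, nsmul_eq_mul, hcard]
    linarith
  rw [hinv, abs_mul, abs_of_pos h2t] at hbound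
  have : |θ S| ≤ (2 ^ t + 2 * κ * 2 ^ t) / 2 ^ t := by
    rw [le_div_iff₀ h2t]; linarith
  rwa [add_div, div_self h2t.ne', mul_div_assoc, div_self h2t.ne', mul_one] at this

end Summit.Parity.GeneralizedHardyLittlewood.Theorems.CellParityLawSaving.Negative

end
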